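import Literature.NumberTheory.EllipticCurves.Kato2004.ZetaIndexInequalitySkeletonProofs
import Literature.NumberTheory.EllipticCurves.SkinnerUrban2014.CharacteristicIdealBaseChangeProofs
import HarnessLib

/-!
# The `Γ`-Euler characteristic is monotone under one-sided divisibility: `char(N) ⊆ char(M)` with
# `N/TN` finite forces `M/TM`, `M[T]` finite and `#(M/TM) · #N[T] ∣ #M[T] · #(N/TN)`

`Proofs` file (theorems only: no definition, no named fact, debt `0`), topic
`NumberTheory/EllipticCurves`, namespace `Literature.NumberTheory.EllipticCurves.IwasawaAlgebra`
(the namespace of `IwasawaEulerCharProofs` / `IwasawaEulerCharRankZeroProofs`, which it continues).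

WHY.  Every «one-sided main conjecture ⟹ level-`0` bound» argument over the cyclotomic
`ℤ_p`-extension (Kato, Astérisque 295, §14.14–14.16 with Lemma 14.15; Greenberg, LNM 1716, Lemma 4.2
and the proof of Thm. 4.1; Perrin-Riou / Schneider) descends a divisibility of characteristic ideals
`char_Λ(N) ⊆ char_Λ(M)` (i.e. `f_M ∣ f_N`; typically `M` = a Selmer dual, `N = 𝐇¹/Λ·z` for an
Euler-system class `z`) to the `Γ = ⟨γ⟩`-(co)invariants: `f_M(0) ∣ f_N(0)` and
`f(0) · #X[T] = u · #(X/TX)` (Greenberg's Lemma 4.2, `X`-side; tree theorem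
`constantCoeff_charGenerator_mul_natCard_invariants`, or the `eulerExp` form
`card_coinvariants_of_lengthAt_eq_zero`: `#(X/TX) = #X[T] · p^{e(X)}`).  The tree had the two halves
(`Kato2004.eulerExp_le_of_lengthAt_le`: `e` is monotone in the local lengths;
`SkinnerUrban2014.lengthAt_le_of_charIdeal_le`: `char ⊆ char` gives the local lengths) but not the
assembled statement, which is what a consumer holding ONLY a divisibility (no exact sequence
(14.14.1), no `𝐇²`) needs — e.g. the fine-Selmer road of cell `bsd-potss` (seat `rkm` g16, crux
stmt-BirchSwinnertonDyer-19196), where Kato's Thm. 13.4 gives `char X₀(E/ℚ_∞) ∣ char(𝐇¹_Γ/Λ𝐲)` and one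
wants `#Sel₀(E/ℚ_∞)^Γ ∣ #Sel₀(E/ℚ_∞)_Γ · [𝐇¹_Γ/T : 𝐲̄]`.

## What is proved (over `Λ = ℤ_p⟦T⟧ = IwasawaAlgebra p`; `M`, `N` finitely generated torsion)

* `finite_coinvariants_of_lengthAt_le` — if `ℓ_𝔮(M) ≤ ℓ_𝔮(N)` at every height-one `𝔮` and `N/TN`
  is finite, then `M/TM` and `M[T]` (and `N[T]`) are finite (`ℓ_{(T)}(M) ≤ ℓ_{(T)}(N) = 0`).
* `natCard_coinvariants_mul_dvd_of_lengthAt_le` — under the same hypotheses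
  **`#(M/TM) · #N[T] ∣ #M[T] · #(N/TN)`** (both sides `= #M[T] · #N[T] · p^{e}` with `e(M) ≤ e(N)`).
* `padicValNat_coinvariants_add_le_of_lengthAt_le` — the same in valuations:
  `v_p #(M/TM) + v_p #N[T] ≤ v_p #M[T] + v_p #(N/TN)`.
* `…_of_charIdeal_le` — the three statements from `char_Λ(N) ⊆ char_Λ(M)` instead of the local lengths
  (`SkinnerUrban2014.lengthAt_le_of_charIdeal_le`).

Nothing here is specific to elliptic curves; no object of Kato's is assumed.  HONEST FRAMING (cell
`bsd-potss`): kernel algebra; nothing is booked; BSD is not advanced by this file.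

## References

* [GreenbergLNM1716] R. Greenberg, *Iwasawa theory for elliptic curves*, LNM 1716 (1999), §4,
  Lemma 4.2 (p. 102) and the proof of Thm. 4.1 (pp. 102–104).
* [Kato2004Asterisque] K. Kato, Astérisque 295 (2004), §14.14 and Lemma 14.15 (pp. 243–244).
* [SkinnerUrban2014] C. Skinner, E. Urban, Invent. Math. 195 (2014), §3.1.6 (divisorial hull of Fitting).
* [Washington1997] L. C. Washington, GTM 83, §13.2.
-/

noncomputable section

open scoped Classical

universe u

namespace Literature.NumberTheory.EllipticCurves.IwasawaAlgebra

open Literature.NumberTheory.EllipticCurves.Kato2004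

variable {p : ℕ} [Fact p.Prime]
variable {M N : Type u} [AddCommGroup M] [Module (IwasawaAlgebra p) M]
  [AddCommGroup N] [Module (IwasawaAlgebra p) N]
  [Module.Finite (IwasawaAlgebra p) M] [Module.Finite (IwasawaAlgebra p) N]

/-! ## From an inequality of local lengths at every height-one prime -/

/-- **`ℓ_𝔮(M) ≤ ℓ_𝔮(N)` (all height-one `𝔮`) and `N/TN` finite ⟹ `M[T]`, `M/TM`, `N[T]` finite.**
`N/TN` finite gives `ℓ_{(T)}(N) = 0` (`Kato2004.lengthAt_primeT_eq_zero_of_finite_coinvariants`), hence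
`ℓ_{(T)}(M) = 0`, and `ℓ_{(T)} = 0` gives the finiteness of `·[T]` and `·/T·`
(`card_coinvariants_of_lengthAt_eq_zero`). [cite: GreenbergLNM1716, §4 Lemma 4.2 (p. 102)] -/
theorem finite_coinvariants_of_lengthAt_le (hM : Module.IsTorsion (IwasawaAlgebra p) M)
    (hN : Module.IsTorsion (IwasawaAlgebra p) N)
    (h : ∀ 𝔮 : PrimeSpectrum (IwasawaAlgebra p), 𝔮.asIdeal.height = 1 →
      Module.lengthAt (IwasawaAlgebra p) M 𝔮 ≤ Module.lengthAt (IwasawaAlgebra p) N 𝔮)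
    (hfin : Finite (coinvariants p N)) :
    Finite (invariants p M) ∧ Finite (coinvariants p M) ∧ Finite (invariants p N) := by
  have hN0 : Module.lengthAt (IwasawaAlgebra p) N (primeT p) = 0 :=
    lengthAt_primeT_eq_zero_of_finite_coinvariants N hN hfin
  have hM0 : Module.lengthAt (IwasawaAlgebra p) M (primeT p) = 0 :=
    le_antisymm ((h (primeT p) (height_primeT p)).trans hN0.le) bot_le
  obtain ⟨h1, h2, -⟩ := card_coinvariants_of_lengthAt_eq_zero M hM hM0
  obtain ⟨h3, -, -⟩ := card_coinvariants_of_lengthAt_eq_zero N hN hN0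
  exact ⟨h1, h2, h3⟩

/-- **`#(M/TM) · #N[T] ∣ #M[T] · #(N/TN)`** for finitely generated torsion `Λ`-modules with
`ℓ_𝔮(M) ≤ ℓ_𝔮(N)` at every height-one prime and `N/TN` finite: by the `Γ`-Euler characteristic
formula `#(X/TX) = #X[T] · p^{e(X)}` (`card_coinvariants_of_lengthAt_eq_zero`, Greenberg's Lemma 4.2 /
Kato's Lemma 14.15 at `a = T`) for `X = M, N` and the monotonicity `e(M) ≤ e(N)`
(`Kato2004.eulerExp_le_of_lengthAt_le`), the quotient of the two sides is `p^{e(N) − e(M)}`.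
[cite: GreenbergLNM1716, §4 Lemma 4.2 (p. 102)] [cite: Kato2004Asterisque, Lemma 14.15 (p. 244)] -/
theorem natCard_coinvariants_mul_dvd_of_lengthAt_le (hM : Module.IsTorsion (IwasawaAlgebra p) M)
    (hN : Module.IsTorsion (IwasawaAlgebra p) N)
    (h : ∀ 𝔮 : PrimeSpectrum (IwasawaAlgebra p), 𝔮.asIdeal.height = 1 →
      Module.lengthAt (IwasawaAlgebra p) M 𝔮 ≤ Module.lengthAt (IwasawaAlgebra p) N 𝔮)
    (hfin : Finite (coinvariants p N)) :
    Nat.card (coinvariants p M) * Nat.card (invariants p N) ∣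
      Nat.card (invariants p M) * Nat.card (coinvariants p N) := by
  have hN0 : Module.lengthAt (IwasawaAlgebra p) N (primeT p) = 0 :=
    lengthAt_primeT_eq_zero_of_finite_coinvariants N hN hfin
  have hM0 : Module.lengthAt (IwasawaAlgebra p) M (primeT p) = 0 :=
    le_antisymm ((h (primeT p) (height_primeT p)).trans hN0.le) bot_le
  obtain ⟨-, -, hcM⟩ := card_coinvariants_of_lengthAt_eq_zero M hM hM0
  obtain ⟨-, -, hcN⟩ := card_coinvariants_of_lengthAt_eq_zero N hN hN0
  have he : eulerExp p M ≤ eulerExp p N := eulerExp_le_of_lengthAt_le hM hN h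
  obtain ⟨k, hk⟩ := Nat.exists_eq_add_of_le he
  refine ⟨p ^ k, ?_⟩
  rw [hcM, hcN, hk, pow_add]
  ring

/-- **`v_p #(M/TM) + v_p #N[T] ≤ v_p #M[T] + v_p #(N/TN)`** — the valuation form of
`natCard_coinvariants_mul_dvd_of_lengthAt_le` (all four groups are finite and non-empty, so the
right-hand side is non-zero and divisibility gives the inequality of `p`-adic valuations).
[cite: GreenbergLNM1716, §4 Lemma 4.2 (p. 102)] [cite: Kato2004Asterisque, Lemma 14.15 (p. 244)] -/
theorem padicValNat_coinvariants_add_le_of_lengthAt_le (hM : Module.IsTorsion (IwasawaAlgebra p) M)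
    (hN : Module.IsTorsion (IwasawaAlgebra p) N)
    (h : ∀ 𝔮 : PrimeSpectrum (IwasawaAlgebra p), 𝔮.asIdeal.height = 1 →
      Module.lengthAt (IwasawaAlgebra p) M 𝔮 ≤ Module.lengthAt (IwasawaAlgebra p) N 𝔮)
    (hfin : Finite (coinvariants p N)) :
    padicValNat p (Nat.card (coinvariants p M)) + padicValNat p (Nat.card (invariants p N)) ≤
      padicValNat p (Nat.card (invariants p M)) + padicValNat p (Nat.card (coinvariants p N)) := by
  haveI : Fact p.Prime := inferInstance
  obtain ⟨hiM, hcM, hiN⟩ := finite_coinvariants_of_lengthAt_le hM hN h hfin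
  haveI := hiM; haveI := hcM; haveI := hiN; haveI := hfin
  have hdvd := natCard_coinvariants_mul_dvd_of_lengthAt_le hM hN h hfin
  have h1 : Nat.card (coinvariants p M) ≠ 0 := Nat.card_pos.ne'
  have h2 : Nat.card (invariants p N) ≠ 0 := Nat.card_pos.ne'
  have h3 : Nat.card (invariants p M) ≠ 0 := Nat.card_pos.ne'
  have h4 : Nat.card (coinvariants p N) ≠ 0 := Nat.card_pos.ne'
  have key : padicValNat p (Nat.card (coinvariants p M) * Nat.card (invariants p N)) ≤
      padicValNat p (Nat.card (invariants p M) * Nat.card (coinvariants p N)) :=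
    (padicValNat_dvd_iff_le (mul_ne_zero h3 h4)).mp (dvd_trans pow_padicValNat_dvd hdvd)
  rwa [padicValNat.mul h1 h2, padicValNat.mul h3 h4] at key

/-! ## From a divisibility of characteristic ideals `char_Λ(N) ⊆ char_Λ(M)` (`f_M ∣ f_N`) -/

/-- `char_Λ(N) ⊆ char_Λ(M)` gives `ℓ_𝔮(M) ≤ ℓ_𝔮(N)` at every height-one `𝔮`
(`SkinnerUrban2014.lengthAt_le_of_charIdeal_le`, the characteristic ideal being the divisorial hull of
the Fitting ideal over the UFD `Λ`). [cite: SkinnerUrban2014, §3.1.6 (p. 20)] [cite: Washington1997, §13.2] -/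
theorem lengthAt_le_of_charIdeal_le' (hM : Module.IsTorsion (IwasawaAlgebra p) M)
    (hN : Module.IsTorsion (IwasawaAlgebra p) N)
    (h : Module.charIdeal (IwasawaAlgebra p) N ≤ Module.charIdeal (IwasawaAlgebra p) M) :
    ∀ 𝔮 : PrimeSpectrum (IwasawaAlgebra p), 𝔮.asIdeal.height = 1 →
      Module.lengthAt (IwasawaAlgebra p) M 𝔮 ≤ Module.lengthAt (IwasawaAlgebra p) N 𝔮 :=
  fun 𝔮 h𝔮 ↦ SkinnerUrban2014.lengthAt_le_of_charIdeal_le hN hM h 𝔮 h𝔮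

/-- **`char_Λ(N) ⊆ char_Λ(M)` and `N/TN` finite ⟹ `M[T]`, `M/TM`, `N[T]` finite.**
[cite: GreenbergLNM1716, §4 Lemma 4.2 (p. 102)] -/
theorem finite_coinvariants_of_charIdeal_le (hM : Module.IsTorsion (IwasawaAlgebra p) M)
    (hN : Module.IsTorsion (IwasawaAlgebra p) N)
    (h : Module.charIdeal (IwasawaAlgebra p) N ≤ Module.charIdeal (IwasawaAlgebra p) M)
    (hfin : Finite (coinvariants p N)) :
    Finite (invariants p M) ∧ Finite (coinvariants p M) ∧ Finite (invariants p N) :=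
  finite_coinvariants_of_lengthAt_le hM hN (lengthAt_le_of_charIdeal_le' hM hN h) hfin

/-- **`char_Λ(N) ⊆ char_Λ(M)` and `N/TN` finite ⟹ `#(M/TM) · #N[T] ∣ #M[T] · #(N/TN)`** — the
`Γ`-level shadow of a one-sided divisibility of characteristic power series (`f_M ∣ f_N` gives
`f_M(0) ∣ f_N(0)`, and `f_X(0) ∼ #(X/TX)/#X[T]`, Greenberg's Lemma 4.2).
[cite: GreenbergLNM1716, §4 Lemma 4.2 (p. 102)] [cite: Kato2004Asterisque, Lemma 14.15 (p. 244)] -/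
theorem natCard_coinvariants_mul_dvd_of_charIdeal_le (hM : Module.IsTorsion (IwasawaAlgebra p) M)
    (hN : Module.IsTorsion (IwasawaAlgebra p) N)
    (h : Module.charIdeal (IwasawaAlgebra p) N ≤ Module.charIdeal (IwasawaAlgebra p) M)
    (hfin : Finite (coinvariants p N)) :
    Nat.card (coinvariants p M) * Nat.card (invariants p N) ∣
      Nat.card (invariants p M) * Nat.card (coinvariants p N) :=
  natCard_coinvariants_mul_dvd_of_lengthAt_le hM hN (lengthAt_le_of_charIdeal_le' hM hN h) hfin

/-- **`char_Λ(N) ⊆ char_Λ(M)` and `N/TN` finite ⟹ `v_p #(M/TM) + v_p #N[T] ≤ v_p #M[T] + v_p #(N/TN)`.**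
[cite: GreenbergLNM1716, §4 Lemma 4.2 (p. 102)] [cite: Kato2004Asterisque, Lemma 14.15 (p. 244)] -/
theorem padicValNat_coinvariants_add_le_of_charIdeal_le (hM : Module.IsTorsion (IwasawaAlgebra p) M)
    (hN : Module.IsTorsion (IwasawaAlgebra p) N)
    (h : Module.charIdeal (IwasawaAlgebra p) N ≤ Module.charIdeal (IwasawaAlgebra p) M)
    (hfin : Finite (coinvariants p N)) :
    padicValNat p (Nat.card (coinvariants p M)) + padicValNat p (Nat.card (invariants p N)) ≤
      padicValNat p (Nat.card (invariants p M)) + padicValNat p (Nat.card (coinvariants p N)) :=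
  padicValNat_coinvariants_add_le_of_lengthAt_le hM hN (lengthAt_le_of_charIdeal_le' hM hN h) hfin

end Literature.NumberTheory.EllipticCurves.IwasawaAlgebra

end
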